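import Summits.ValiantsHypothesis.ValiantsHypothesis.Theorems.DepthWindowDualitySPS
import HarnessLib

/-!
# Route `DepthWindow`, g17 — duality halving II: truncated gate values, re-mapping, the symbolic circuit

Second of five files proving `DualityHalving` (`Theorems/DepthWindowDualityHalvingProof.lean`).
§3 `Circuit`: for a circuit `D` all of whose gate values are homogeneous and a degree `d ≥ 1`:
the truncated value `tv i = trunc d (gateVal i)` of gate `i` (the value or `0`); the X-type
(nonconstant earlier-gate or variable) operands `isX` of a gate and the constants `cval` of the
others; a nonconstant product gate has at most `d` X-type operands and its value is
`(∏ constants) • ∏ (X-type values)` (`length_filter_isX_le`, `tv_eq_smul_prod_filter`); the product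
level of a product gate (`gatePD_of_prod`); re-mapping the operands of gate `i` to operands of the
new circuit (`remap`, `eval_remap`, `depthIn_remap_le`).
§4 `Sym`: the SYMBOLIC CIRCUIT `symC d D L` over the atom variables `Fin D.size ⊕ σ`: a gate with
constant truncated value becomes that constant, a nonconstant gate of level `≤ L` (an ATOM) becomes
its own variable, every other gate is re-read verbatim; substituting the truncated values for the
atoms of level `≤ L` recovers the truncated values of all gates (`aeval_symC_gateVal`).
[cite: GuptaKamathKayalSaptharishi2016, §4] [cite: Burgisser2000, Def. 2.1] [cite: LST2021, §2]
-/

-- layout Summits/ValiantsHypothesis/ValiantsHypothesis forces the duplicated namespace component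
set_option linter.dupNamespace false

namespace Summit.ValiantsHypothesis.ValiantsHypothesis.Theorems.DepthWindow

open MvPolynomial Literature.Computability.AlgebraicComplexity ArithCircuit
open Literature.Computability.AlgebraicComplexity.DepthReduction
open Literature.Computability.AlgebraicComplexity.DepthThreeChasm

section Circuit

variable {σ : Type*} (d : ℕ) (D : ArithCircuit ℂ σ)

variable {D} in
/-- Gate values of a circuit with homogeneous gate values are homogeneous (junk gates are `0`).
[cite: Burgisser2000, Def. 2.1] -/
theorem gateVal_isHomogeneous (h : ∀ g ∈ gateValues D.gates, ∃ e : ℕ, g.IsHomogeneous e)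
    (i : ℕ) : ∃ e, (D.gateVal i).IsHomogeneous e := by
  by_cases hi : i < D.size
  · have hlen : i < (gateValues D.gates).length := by rw [gateValues_length]; exact hi
    have hval : D.gateVal i = (gateValues D.gates)[i] := by
      rw [ArithCircuit.gateVal, List.getD_eq_getElem?_getD, List.getElem?_eq_getElem hlen,
        Option.getD_some]
    rw [hval]
    exact h _ (List.getElem_mem hlen)
  · exact ⟨0, by rw [gateVal_of_le D (not_lt.1 hi)]; exact isHomogeneous_zero σ ℂ 0⟩

variable {D} in
/-- Operand values of a circuit with homogeneous gate values are homogeneous.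
[cite: Burgisser2000, Def. 2.1] -/
theorem opVal_isHomogeneous (h : ∀ g ∈ gateValues D.gates, ∃ e : ℕ, g.IsHomogeneous e) (i : ℕ) :
    ∀ u : Operand ℂ σ, ∃ e, (D.opVal i u).IsHomogeneous e
  | .var t => ⟨1, isHomogeneous_X ℂ t⟩
  | .const c => ⟨0, isHomogeneous_C σ c⟩
  | .gate j => by
      rw [opVal_gate]
      split_ifs
      · exact gateVal_isHomogeneous h j
      · exact ⟨0, isHomogeneous_zero σ ℂ 0⟩

/-- The truncated value of gate `i`. [cite: GuptaKamathKayalSaptharishi2016, §4] -/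
noncomputable def tv (i : ℕ) : MvPolynomial σ ℂ := trunc d (D.gateVal i)

/-- Unfolding `tv`. -/
theorem tv_def (i : ℕ) : tv d D i = trunc d (D.gateVal i) := rfl

/-- Junk gates have truncated value `0`. -/
theorem tv_of_size_le {i : ℕ} (hi : D.size ≤ i) : tv d D i = 0 := by
  rw [tv, gateVal_of_le D hi, map_zero]

variable {D} in
/-- A gate with nonconstant truncated value: the value is nonzero, homogeneous of degree `≤ d`,
and equal to its truncation. -/
theorem tv_spec (h : ∀ g ∈ gateValues D.gates, ∃ e : ℕ, g.IsHomogeneous e) {i : ℕ} (hk : (tv d D i).totalDegree ≠ 0) :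
    tv d D i = D.gateVal i ∧ D.gateVal i ≠ 0 ∧ ∃ e ≤ d, (D.gateVal i).IsHomogeneous e :=
  trunc_spec_of_ne_zero (gateVal_isHomogeneous h i) fun h0 => hk (by rw [tv_def, h0, totalDegree_zero])

/-- A gate with nonconstant truncated value is a genuine gate. -/
theorem lt_size_of_tv {i : ℕ} (hk : (tv d D i).totalDegree ≠ 0) : i < D.size := by
  by_contra hi
  exact hk (by rw [tv_of_size_le d D (not_lt.1 hi), totalDegree_zero])

/-- A constant truncated value is the constant. -/
theorem tv_eq_C {i : ℕ} (hk : (tv d D i).totalDegree = 0) :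
    tv d D i = C (coeff 0 (tv d D i)) :=
  totalDegree_eq_zero_iff_eq_C.1 hk

/-! #### Operands: the nonconstant ("X-type") ones and the constant parts of the others -/

/-- X-type operands of gate `i`: variables, and references to earlier gates with nonconstant
truncated value. -/
noncomputable def isX (i : ℕ) : Operand ℂ σ → Bool
  | .var _ => true
  | .const _ => false
  | .gate j => decide (j < i) && !decide ((tv d D j).totalDegree = 0)

/-- The constant a non-X-type operand of gate `i` truncates to. -/
noncomputable def cval (i : ℕ) : Operand ℂ σ → ℂ
  | .var _ => 0
  | .const c => c
  | .gate j => if j < i then coeff 0 (tv d D j) else 0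

/-- A gate operand is X-type iff it is an earlier gate with nonconstant truncated value. -/
theorem isX_gate_iff {i j : ℕ} :
    isX d D i (.gate j) = true ↔ j < i ∧ (tv d D j).totalDegree ≠ 0 := by
  simp [isX]

/-- A non-X-type operand truncates to its constant. -/
theorem trunc_opVal_of_isX_false {i : ℕ} :
    ∀ {u : Operand ℂ σ}, isX d D i u = false → trunc d (D.opVal i u) = C (cval d D i u)
  | .var _, h => by simp [isX] at h
  | .const c, _ => by rw [opVal_const, trunc_C]; rfl
  | .gate j, h => by
      rw [opVal_gate]
      by_cases hj : j < i
      · have hk : (tv d D j).totalDegree = 0 := by simpa [isX, hj] using h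
        rw [if_pos hj, cval, if_pos hj, ← tv_eq_C d D hk, tv_def]
      · rw [if_neg hj, cval, if_neg hj, map_zero, C_0]

variable {D} in
/-- An X-type operand has a nonconstant value. -/
theorem totalDegree_opVal_ne_zero_of_isX (h : ∀ g ∈ gateValues D.gates, ∃ e : ℕ, g.IsHomogeneous e) {i : ℕ} :
    ∀ {u : Operand ℂ σ}, isX d D i u = true → (D.opVal i u).totalDegree ≠ 0
  | .var t, _ => by rw [opVal_var, totalDegree_X]; exact one_ne_zero
  | .const c, hx => by simp [isX] at hx
  | .gate j, hx => by
      obtain ⟨hj, hk⟩ := (isX_gate_iff d D).1 hx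
      rw [opVal_gate, if_pos hj, ← (tv_spec d h hk).1]
      exact hk

variable {D} in
/-- **At most `d` X-type operands** in a product gate with nonconstant truncated value.
[cite: GuptaKamathKayalSaptharishi2016, §4] -/
theorem length_filter_isX_le (h : ∀ g ∈ gateValues D.gates, ∃ e : ℕ, g.IsHomogeneous e) {i : ℕ} {us : List (Operand ℂ σ)}
    (hg : D.gates[i]? = some (.prod us)) (hk : (tv d D i).totalDegree ≠ 0) :
    (us.filter (isX d D i)).length ≤ d := by
  obtain ⟨-, hne, e, hed, he⟩ := tv_spec d h hk
  rw [gateVal_of_prod D hg] at hne he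
  exact (length_filter_le_of_prod us (D.opVal i) (isX d D i) (fun u _ => opVal_isHomogeneous h i u)
    (fun u _ hu => totalDegree_opVal_ne_zero_of_isX d h hu) he hne).trans hed

variable {D} in
/-- **Splitting a good product gate**: its (truncated) value is the product of the constants of
its non-X-type operands times the product of the truncated values of its X-type operands.
[cite: GuptaKamathKayalSaptharishi2016, §4] -/
theorem tv_eq_smul_prod_filter (h : ∀ g ∈ gateValues D.gates, ∃ e : ℕ, g.IsHomogeneous e) {i : ℕ} {us : List (Operand ℂ σ)}
    (hg : D.gates[i]? = some (.prod us)) (hk : (tv d D i).totalDegree ≠ 0) :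
    tv d D i = ((us.filter fun u => !isX d D i u).map (cval d D i)).prod •
      ((us.filter (isX d D i)).map fun u => trunc d (D.opVal i u)).prod := by
  obtain ⟨htv, hne, e, hed, he⟩ := tv_spec d h hk
  rw [gateVal_of_prod D hg] at hne he htv
  rw [htv, ← trunc_list_prod _ (fun v hv => by
      obtain ⟨u, _, rfl⟩ := List.mem_map.1 hv; exact opVal_isHomogeneous h i u) he hed hne, List.map_map]
  have hperm := List.filter_append_perm (isX d D i) us
  rw [← hperm.map _ |>.prod_eq, List.map_append, List.prod_append, mul_comm, smul_eq_C_mul]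
  congr 1
  rw [map_list_prod, List.map_map]
  refine congrArg List.prod (List.map_congr_left fun u hu => ?_)
  have hx : isX d D i u = false := by
    have := (List.mem_filter.1 hu).2
    simpa using this
  simp only [Function.comp_apply, trunc_opVal_of_isX_false d D hx]

/-! #### Product levels of gates -/

/-- The product level of a product gate is one more than the largest level of its operands.
[cite: LimayeSrinivasanTavenas2025, §1] -/
theorem gatePD_of_prod {i : ℕ} {us : List (Operand ℂ σ)} (hg : D.gates[i]? = some (.prod us)) :
    D.gatePD i = (us.map (D.opPD i)).foldr max 0 + 1 := by
  unfold gatePD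
  rw [List.getD_eq_getElem?_getD, gateWDepths_getElem? prodWeight D.gates i _ hg, Option.getD_some]
  simp only [prodWeight, Gate.isProd, if_true, Gate.args]
  rw [Nat.add_comm]
  congr 2
  exact List.map_congr_left fun u _ => depthIn_gateWDepths_take D i u

/-! #### Re-mapping the operands of gate `i` into the new circuit -/

/-- Re-map an operand of gate `i` of `D`: variables and constants stay, a reference to an earlier
gate `j` becomes the operand `O j` (computing `tv j` in the new circuit), junk becomes `0`.
[cite: Burgisser2000, Def. 2.1] -/
def remap (O : ℕ → Operand ℂ σ) (i : ℕ) : Operand ℂ σ → Operand ℂ σ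
  | .var t => .var t
  | .const c => .const c
  | .gate j => if j < i then O j else .const 0

/-- The re-mapped operand computes the truncated value of the original operand.
[cite: Burgisser2000, Def. 2.1] -/
theorem eval_remap (hd : 1 ≤ d) {O : ℕ → Operand ℂ σ} {i : ℕ} {VA : List (MvPolynomial σ ℂ)}
    (hO : ∀ j < i, (O j).eval VA = tv d D j) :
    ∀ u : Operand ℂ σ, (remap O i u).eval VA = trunc d (D.opVal i u)
  | .var t => by rw [remap, Operand.eval, opVal_var, trunc_X hd]
  | .const c => by rw [remap, Operand.eval, opVal_const, trunc_C]
  | .gate j => by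
      rw [opVal_gate]
      simp only [remap]
      split_ifs with hj
      · rw [hO j hj, tv_def]
      · rw [Operand.eval, map_zero, map_zero]

/-- The re-mapped operand has product level at most half (rounded up) the original level.
[cite: LST2021, §2] -/
theorem depthIn_remap_le {O : ℕ → Operand ℂ σ} {i : ℕ} {DA : List ℕ}
    (hO : ∀ j < i, (O j).depthIn DA ≤ (D.gatePD j + 1) / 2) :
    ∀ u : Operand ℂ σ, (remap O i u).depthIn DA ≤ (D.opPD i u + 1) / 2
  | .var _ => by simp [remap, Operand.depthIn]
  | .const _ => by simp [remap, Operand.depthIn]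
  | .gate j => by
      rw [opPD_gate]
      simp only [remap]
      split_ifs with hj
      · exact hO j hj
      · simp [Operand.depthIn]

end Circuit

/-! ### The symbolic circuit over the atoms -/

section Sym

variable {σ : Type*} (d : ℕ) (D : ArithCircuit ℂ σ)

/-- Gate `i` re-read over the atom variables `Fin D.size ⊕ σ` at atom level `L`.
[cite: GuptaKamathKayalSaptharishi2016, §4] -/
noncomputable def symGate (L i : ℕ) : Gate ℂ (Fin D.size ⊕ σ) :=
  if (tv d D i).totalDegree = 0 then .sum [(coeff 0 (tv d D i), .const 1)]
  else if D.gatePD i ≤ L then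
    .sum [(1, if h : i < D.size then .var (Sum.inl ⟨i, h⟩) else .const 0)]
  else (D.gates.getD i (.sum [])).rename Sum.inr

/-- The symbolic circuit at atom level `L`. [cite: GuptaKamathKayalSaptharishi2016, §4] -/
noncomputable def symC (L : ℕ) : ArithCircuit ℂ (Fin D.size ⊕ σ) :=
  ⟨(List.range D.size).map (symGate d D L), .const 0⟩

/-- The symbolic circuit has as many gates as `D`. -/
theorem size_symC (L : ℕ) : (symC d D L).size = D.size := by
  simp [symC, ArithCircuit.size]

/-- The `i`-th gate of the symbolic circuit. -/
theorem symC_gates_getElem? (L : ℕ) {i : ℕ} (hi : i < D.size) :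
    (symC d D L).gates[i]? = some (symGate d D L i) := by
  simp [symC, List.getElem?_range hi]

/-- The three shapes of a symbolic gate. -/
theorem symC_gates_of_const (L : ℕ) {i : ℕ} (hi : i < D.size) (hk : (tv d D i).totalDegree = 0) :
    (symC d D L).gates[i]? = some (.sum [(coeff 0 (tv d D i), .const 1)]) := by
  rw [symC_gates_getElem? d D L hi, symGate, if_pos hk]

/-- The symbolic gate of an atom. -/
theorem symC_gates_of_atom (L : ℕ) {i : ℕ} (hi : i < D.size) (hk : (tv d D i).totalDegree ≠ 0)
    (hL : D.gatePD i ≤ L) :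
    (symC d D L).gates[i]? = some (.sum [(1, .var (Sum.inl ⟨i, hi⟩))]) := by
  rw [symC_gates_getElem? d D L hi, symGate, if_neg hk, if_pos hL, dif_pos hi]

/-- The symbolic gate of a nonconstant gate of level `> L`: the renamed original gate. -/
theorem symC_gates_of_high (L : ℕ) {i : ℕ} {g : Gate ℂ σ} (hg : D.gates[i]? = some g)
    (hk : (tv d D i).totalDegree ≠ 0) (hL : ¬ D.gatePD i ≤ L) :
    (symC d D L).gates[i]? = some (g.rename Sum.inr) := by
  have hi : i < D.size := (List.getElem?_eq_some_iff.1 hg).1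
  rw [symC_gates_getElem? d D L hi, symGate, if_neg hk, if_neg hL, List.getD_eq_getElem?_getD, hg,
    Option.getD_some]

/-- Value of a constant symbolic gate. -/
theorem symC_gateVal_of_const (L : ℕ) {i : ℕ} (hi : i < D.size)
    (hk : (tv d D i).totalDegree = 0) :
    (symC d D L).gateVal i = C (coeff 0 (tv d D i)) := by
  rw [gateVal_of_sum _ (symC_gates_of_const d D L hi hk)]
  simp only [List.map_cons, List.map_nil, List.sum_cons, List.sum_nil, add_zero, opVal_const,
    C_1, smul_eq_C_mul, mul_one]

/-- Value of an atom gate. -/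
theorem symC_gateVal_of_atom (L : ℕ) {i : ℕ} (hi : i < D.size) (hk : (tv d D i).totalDegree ≠ 0)
    (hL : D.gatePD i ≤ L) :
    (symC d D L).gateVal i = X (Sum.inl ⟨i, hi⟩) := by
  rw [gateVal_of_sum _ (symC_gates_of_atom d D L hi hk hL)]
  simp only [List.map_cons, List.map_nil, List.sum_cons, List.sum_nil, add_zero, opVal_var,
    one_smul]

variable {D} in
/-- **Semantics of the symbolic circuit**: substituting for each atom of level `≤ L` among the
first `m` gates its truncated value (and `X t` for `inr t`) turns the symbolic value of every gate
`i < m` into its truncated value. [cite: GuptaKamathKayalSaptharishi2016, §4] -/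
theorem aeval_symC_gateVal (hd : 1 ≤ d) (h : ∀ g ∈ gateValues D.gates, ∃ e : ℕ, g.IsHomogeneous e) (L m : ℕ)
    (Θ : Fin D.size ⊕ σ → MvPolynomial σ ℂ) (hΘv : ∀ t, Θ (Sum.inr t) = X t)
    (hΘa : ∀ j : Fin D.size, (j : ℕ) < m → (tv d D j).totalDegree ≠ 0 → D.gatePD j ≤ L →
      Θ (Sum.inl j) = tv d D j) :
    ∀ i < m, aeval Θ ((symC d D L).gateVal i) = tv d D i := by
  intro i
  induction i using Nat.strong_induction_on with
  | _ i ih =>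
  intro him
  have hop : ∀ u : Operand ℂ σ,
      aeval Θ ((symC d D L).opVal i (u.rename Sum.inr)) = trunc d (D.opVal i u) := by
    intro u
    cases u with
    | var t => rw [Operand.rename, opVal_var, aeval_X, hΘv, opVal_var, trunc_X hd]
    | const c => rw [Operand.rename, opVal_const, algHom_C, algebraMap_eq, opVal_const, trunc_C]
    | gate j =>
        rw [Operand.rename, opVal_gate, opVal_gate]
        split_ifs with hj
        · rw [ih j hj (lt_trans hj him), tv_def]
        · rw [map_zero, map_zero]
  by_cases hi : i < D.size
  swap
  · rw [gateVal_of_le _ (by rw [size_symC]; exact not_lt.1 hi), map_zero,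
      tv_of_size_le d D (not_lt.1 hi)]
  by_cases hk : (tv d D i).totalDegree = 0
  · rw [symC_gateVal_of_const d D L hi hk, algHom_C, algebraMap_eq, ← tv_eq_C d D hk]
  by_cases hL : D.gatePD i ≤ L
  · rw [symC_gateVal_of_atom d D L hi hk hL, aeval_X, hΘa ⟨i, hi⟩ him hk hL]
  obtain ⟨g, hg⟩ : ∃ g, D.gates[i]? = some g := ⟨D.gates[i], List.getElem?_eq_getElem hi⟩
  have hsym := symC_gates_of_high d D L hg hk hL
  obtain ⟨htv, hne, e, hed, he⟩ := tv_spec d h hk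
  cases g with
  | sum args =>
      rw [Gate.rename] at hsym
      rw [gateVal_of_sum _ hsym, tv_def, gateVal_of_sum D hg, map_list_sum, map_list_sum,
        List.map_map, List.map_map, List.map_map]
      congr 1
      refine List.map_congr_left fun a _ => ?_
      simp only [Function.comp_apply, map_smul, hop]
  | prod us =>
      rw [Gate.rename] at hsym
      rw [gateVal_of_prod _ hsym, map_list_prod, List.map_map, List.map_map]
      have hl : us.map ((⇑(aeval Θ) ∘ (symC d D L).opVal i) ∘ Operand.rename Sum.inr) =
          (us.map (D.opVal i)).map (trunc d) := by
        rw [List.map_map]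
        exact List.map_congr_left fun u _ => by simp only [Function.comp_apply, hop u]
      rw [gateVal_of_prod D hg] at htv hne he
      rw [hl, htv]
      exact trunc_list_prod _ (fun v hv => by
        obtain ⟨u, _, rfl⟩ := List.mem_map.1 hv
        exact opVal_isHomogeneous h i u) he hed hne

end Sym

end Summit.ValiantsHypothesis.ValiantsHypothesis.Theorems.DepthWindow
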